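import Literature.AlgebraicGeometry.ComplexMultiplication.CyclotomicFermatCMTypesProductsOfEllipticCurves
import Literature.AlgebraicGeometry.ComplexMultiplication.CyclotomicFermatCMTypesFixedFieldOfStabilizer
import Literature.AlgebraicGeometry.ComplexMultiplication.CyclotomicFermatCMTypesTwoPowerLevelIsogenies
import HarnessLib

/-!
# Bauer–Coste–Itzykson–Ruelle §3.4 at the levels `8` and `12`: the CM fields `ℚ(√−2)`, `ℚ(i)`, `ℚ(√−3)` of the elliptic factors,
# and the printed counts `F_8 ∼ [ℤ(√−2)]^{12} ⊕ [ℤ(i)]^9`, `F_{12} ∼ [ℤ(ω)]^{28} ⊕ [ℤ(i)]^{27}` as counts of triples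

Layer `Literature/AlgebraicGeometry/ComplexMultiplication`; sequel of `CyclotomicFermatCMTypesProductsOfEllipticCurves` (this lane gen 41:
«`F_n` is isogenous to a product of elliptic curves iff `n ≤ 12` divides `24`» read on the Koblitz–Rohrlich factor types — at the GOOD
levels `3, 4, 6, 8, 12` every abelian variety with complex multiplication by `ℚ(ζ_n)` is isogenous to a power `E^h` of an elliptic curve;
honest column (c): «NOT typed: the explicit decompositions `F_8 ∼ [ℤ(√−2)]^{12} ⊕ [ℤ(i)]^9`, `F_12 ∼ …` and the CM fields `ℚ(i)`,
`ℚ(√−2)`, `ℚ(ω)` of the elliptic factors») and of `CyclotomicFermatCMTypesFixedFieldOfStabilizer` (the field `K₁` of the simple factor as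
the fixed field of `{σ_w | w ∈ W}`; `N = 7`: `K₁ = ℚ(√−7)`).  THIS FILE types the last paragraph of BCIR §3.4 at `n = 8` and `n = 12`.
THEOREMS ONLY (no definition, no named fact, no `sorry`; kernel `decide` for residue arithmetic modulo `8` and `12` and for the three
printed triple counts at `8`, `12`, `24` — the last under `maxRecDepth 100000`, ≈ 20 s).

THE SOURCE.  M. Bauer, A. Coste, C. Itzykson, P. Ruelle, *Comments on the links between su(3) modular invariants, simple factors in the
Jacobian of Fermat curves, and rational triangular billiards*, J. Geom. Phys. **22** (1997) 134–189, §3.4 (held `paper:arxiv-hep-th_9604104`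
p. 14, read first-hand): «It is straightforward to compute the decomposition of `F_n` for `n | 24`. For `n = 3, 4` and `6`, all `L_{r,s,t}`
are already 1-dimensional, isogenous to `ℤ(ω = exp 2iπ/3)` for `n = 3` and `6`, and to `ℤ(i)` for `n = 4`. For `n = 8`, `H_{r,s,t}` can
only be `{1,3}` or `{1,5}` if it is of order 2. One finds `K = ℚ(√−2)` if `H_{r,s,t} = {1,3}` and `K = ℚ(i)` if `H_{r,s,t} = {1,5}`. Apart
from `(r,s,t) = (2,2,4), (2,4,2)` and `(4,2,2)` which have their `H_{r,s,t}` equal to `{1}` and their `L_{r,s,t}` isogenous to `ℤ(i)`, the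
complete decomposition of `F_8` follows by merely counting how many triplets have a `H_{r,s,t}` equal to `{1,3}` or to `{1,5}`. Similarly
for `n = 12`, a set `H_{r,s,t}` of order 2 can only be `{1,5}` or `{1,7}`, yielding respectively `L_{r,s,t} ∼ [ℤ(i)]²` or
`L_{r,s,t} ∼ [ℤ(ω)]²`. … Putting everything together, one obtains `F_3 ∼ ℤ(ω)`, `F_4 ∼ [ℤ(i)]³`, `F_6 ∼ [ℤ(ω)]^{10}`,
`F_8 ∼ [ℤ(√−2)]^{12} ⊕ [ℤ(i)]^9`, `F_{12} ∼ [ℤ(ω)]^{28} ⊕ [ℤ(i)]^{27}`».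

READING (as in the siblings).  `W = W(S)` is the residue stabiliser `{t ∈ (ℤ/N)ˣ | ∀ c ∈ (ℤ/N)ˣ, ct ∈ S ⟺ c ∈ S}` (the `Finset.filter`
expression); «`K`» is the field `K₁` of ANY primitive sub-pair `(K₁, Φ₁)` inducing the CM type `Φ` of `L = ℚ(ζ_n)` (the field of complex
multiplication of the simple factor `E`, gen 14 `exists_isIsogeny_power_simple_cyclotomic`); «`K = ℚ(√−2)`» is typed as
`K₁ = ℚ(ζ₈ + ζ₈³) = IntermediateField.adjoin ℚ {ζ₈ + ζ₈³}` with `(ζ₈ + ζ₈³)² = −2` and `[K₁ : ℚ] = 2`; «`ℚ(i)`» as `ℚ(ζ₈²)`,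
`(ζ₈²)² = −1` (resp. `ℚ(ζ₁₂³)`, `(ζ₁₂³)² = −1`); «`ℚ(ω)`» as `ℚ(1 + 2ζ₁₂⁴)` with `(1 + 2ζ₁₂⁴)² = −3`, `ζ₁₂⁴ = ω`, `ω² + ω + 1 = 0`.  At
these levels `H_{r,s,t}` — computed at level `n` for the representative with `0 < r, s, t < n`, `r + s + t = n` — is a group equal to `W`
(BCIR; for a CM residue set `S ∋ 1` at a good level `S = W(S)`, `eq_stabilizerResidues_of_one_mem_eight/twelve`), so «how many triplets have
`H` equal to `{1,3}`» is a finite count over the `21` (resp. `55`) admissible triples, INCLUDING the non-primitive ones (`(2,2,4)` etc. have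
level-`8` set `H = {1,5}`, i.e. `ℤ(i)`, consistently with BCIR's `n₀ = 4`).  The Jacobian `J(F_n) ∼ ∏ L_{r,s,t}` itself is NOT constructed:
the exponents `12, 9` and `28, 27` are typed as NUMBERS OF TRIPLES with the respective `H`, which is exactly BCIR's bookkeeping.

## What is proved

* §0 (any `N`): `neg_one_notMem_stabilizerResidues` (`−1 ∉ W(S)` for a CM residue set), `stabilizerResidues_eq_pair_of_mem` (`2|W| ≤ φ(N) = 4`,
  `W ∋ t ≠ 1` ⟹ `W = {1, t}`), `finrank_eq_two_of_primitive_of_card_eq_two`, `mem_of_stabilizerResidues_eq_pair` (`W = {1, t}`, `σ_t δ = δ` ⟹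
  `δ ∈ K₁`), **`exists_isIsogeny_sq_elliptic_of_card_eq_two`** (`φ(N) = 4`, `|W| = 2`: `A` is a surface `∼ E × E`, `E` elliptic with CM
  `𝓞_{K₁} → End E`, `[K₁ : ℚ] = 2`); private helper `eq_adjoin_of_mem_of_sq_eq_neg` (`δ ∈ K₁`, `δ² = −m < 0`, `[K₁ : ℚ] = 2` ⟹ `K₁ = ℚ(δ)`).
* §1 LEVEL `8` (`L = ℚ(ζ₈)`, any model; private `ζ₈⁴ = −1`, `(ℤ/8)ˣ = {1,3,5,7}`): **`sq_zetaOf_add_pow_three_eight`** (`(ζ₈ + ζ₈³)² = −2`),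
  `sq_zetaOf_sq_eight` (`(ζ₈²)² = −1`), **`stabilizerResidues_eq_or_eight`** («`H` can only be `{1,3}` or `{1,5}`»: for EVERY CM residue set `S`
  mod `8`, `W(S) = {1,3}` or `W(S) = {1,5}`), `eq_stabilizerResidues_of_one_mem_eight` (`1 ∈ S` ⟹ `S = W(S)`), `apply_sqrt_neg_two_eight`,
  `apply_sqrt_neg_one_eight` (`σ_3`, `σ_5` fix `ζ₈ + ζ₈³`, `ζ₈²`); for every CM type `Φ` of `ℚ(ζ₈)` and ANY primitive sub-pair `(K₁, Φ₁)`: **`eq_adjoin_sqrt_neg_two_of_three_mem_eight`**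
  («`K = ℚ(√−2)` if `H = {1,3}`»: `3 ∈ W` ⟹ `ζ₈ + ζ₈³ ∈ K₁ = ℚ(ζ₈ + ζ₈³)`, `[K₁ : ℚ] = 2`), **`eq_adjoin_sqrt_neg_one_of_five_mem_eight`**
  («`K = ℚ(i)` if `H = {1,5}`»: `5 ∈ W` ⟹ `K₁ = ℚ(ζ₈²)`); ON ABELIAN SURFACES: **`exists_isIsogeny_sq_elliptic_eight_of_three_mem`** — every
  abelian variety `A` of a type `Φ` of `ℚ(ζ₈)` with `3 ∈ W` is an abelian surface `𝓞_{K₁}`-equivariantly isogenous to `E × E`, `E` an ELLIPTIC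
  CURVE with complex multiplication `𝓞_{K₁} → End E`, `K₁ = ℚ(ζ₈ + ζ₈³)`, `(ζ₈ + ζ₈³)² = −2`; **`exists_isIsogeny_sq_elliptic_eight_of_five_mem`**
  (`5 ∈ W`: the same with `K₁ = ℚ(ζ₈²)`, `(ζ₈²)² = −1`); `exists_isIsogeny_sq_elliptic_eight` (every `A`: one of the two).
* §2 LEVEL `12` (private `ζ₁₂⁶ = −1`, `(ℤ/12)ˣ = {1,5,7,11}`): `sq_zetaOf_pow_three_twelve` (`(ζ₁₂³)² = −1`),
  **`omega_sq_add_omega_add_one_twelve`** (`ω² + ω + 1 = 0`, `ω = ζ₁₂⁴`), **`sq_one_add_two_omega_twelve`** (`(1 + 2ω)² = −3`),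
  **`stabilizerResidues_eq_or_twelve`** (`W(S) = {1,5}` or `{1,7}`), `eq_stabilizerResidues_of_one_mem_twelve`, `apply_sqrt_neg_one_twelve`,
  `apply_sqrt_neg_three_twelve`;
  **`eq_adjoin_sqrt_neg_one_of_five_mem_twelve`** (`5 ∈ W` ⟹ `K₁ = ℚ(ζ₁₂³)`), **`eq_adjoin_sqrt_neg_three_of_seven_mem_twelve`** (`7 ∈ W` ⟹
  `K₁ = ℚ(1 + 2ζ₁₂⁴) ∋ ζ₁₂⁴ = ω`); **`exists_isIsogeny_sq_elliptic_twelve_of_five_mem`** (`A ∼ E × E`, `E` CM by `𝓞_{K₁}`, `K₁ = ℚ(ζ₁₂³)` —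
  «`[ℤ(i)]²`»), **`exists_isIsogeny_sq_elliptic_twelve_of_seven_mem`** (`K₁ = ℚ(1 + 2ω)` — «`[ℤ(ω)]²`»), `exists_isIsogeny_sq_elliptic_twelve`.
* §3 THE KOBLITZ–ROHRLICH TRIPLES AND BCIR'S COUNTS (namespace `…CyclotomicFermatCMType`; the level-`8` examples
  `H_{1,1,6} = H_{1,3,4} = {1,3}`, `H_{1,2,5} = H_{2,2,4} = {1,5}` are the sibling's `fermatCMType_eight_values`), **`card_triples_eight`** — among the `21` admissible triples
  `(r, s, t)`, `0 < r,s,t < 8`, `r + s + t = 8`: exactly `12` have `H_{r,s,t} = {1,3}` and exactly `9` have `H_{r,s,t} = {1,5}` (the `3`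
  non-primitive ones `(2,2,4), (2,4,2), (4,2,2)` among the latter) — BCIR's `F_8 ∼ [ℤ(√−2)]^{12} ⊕ [ℤ(i)]^9`; **`card_triples_twelve`** — among the
  `55` admissible triples mod `12`: exactly `28` have `H = {1,7}` and `27` have `H = {1,5}` — BCIR's `F_{12} ∼ [ℤ(ω)]^{28} ⊕ [ℤ(i)]^{27}`;
  **`card_triples_twentyFour`** — among the `253` admissible triples mod `24` exactly `157` have `H` closed under multiplication (the
  elliptic ones) and `96 = 24 · 4` have `H` one of the four unit multiples of `{1,5,11,17} = H_{1,3,20}` (`24` each) — BCIR's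
  `F_{24} ∼ [ℂ⁴/L_{1,3,20}]^{24} ⊕ [157 elliptic curves]`; and on abelian varieties **`exists_isIsogeny_sq_elliptic_fermat_eight_of_eq_pair`** ∕ **`…_eq_pair'`** (a K–R type `Φ_{H_τ}` mod `8` with
  `H_τ = {1,3}` (resp. `{1,5}`): every realisation `∼ E × E`, `E` with CM by `𝓞_{ℚ(√−2)}` (resp. `𝓞_{ℚ(i)}`) in the above sense),
  **`exists_isIsogeny_sq_elliptic_fermat_twelve_of_eq_pair`** ∕ **`…_eq_pair'`** (`H_τ = {1,5}`: `ℚ(i)`; `H_τ = {1,7}`: `ℚ(ω)`), with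
  non-vacuity `exists_realisation_fermat_eight` (`(1,1,6)` and `(1,2,5)`), `exists_realisation_fermat_twelve` (`(1,1,10)` and `(1,4,7)`).

## Honest column

(a) The Fermat curves `F_8`, `F_{12}`, their Jacobians and the decomposition `J(F_n) ∼ ∏_{[r,s,t]} L_{r,s,t}` are NOT constructed (the
tree's record of the factors inside the Jacobian is the unused FACT `HodgeTheory.Aoki2002_fermatFactor_cmTypeOf`): the exponents `12, 9, 28,
27` are typed as counts of triples by their `H`, exactly BCIR's «merely counting how many triplets have a `H_{r,s,t}` equal to `{1,3}` or to
`{1,5}`»; `F_3`, `F_4`, `F_6` (all factors 1-dimensional) are the trivial counts `1, 3, 10` of admissible triples and are not spelled out.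
(b) «`ℤ(√−2)`, `ℤ(i)`, `ℤ(ω)`» name the elliptic curves by their endomorphism rings (maximal orders); the tree's `E` carries `𝓞_{K₁} → End E`
with `K₁ = ℚ(√−2)`, `ℚ(i)`, `ℚ(√−3)` identified as explicit subfields `ℚ(δ) ⊂ ℚ(ζ_n)` with `δ²  = −2, −1, −3`; the rings of integers of
these quadratic fields are not computed, and `E` is determined only up to isogeny.  (c) At `n = 24` only the COUNT is typed (`157`
triples with `H` a group, `96` in the class of `H_{1,3,20}`); that the `96` give «24 copies of one fourfold» uses, beyond the count, the
isogeny `A_{uτ} ∼ A_τ` (gen 14) and is not assembled; the CM fields of the `157` elliptic curves at `24` are not listed.  The Hodge conjecture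
is not proved and nothing here bears on it.
-/

noncomputable section

open NumberField

namespace Literature.AlgebraicGeometry.ComplexMultiplication

open CategoryTheory CategoryTheory.Limits
open Literature.AlgebraicGeometry.Motives (CMType AbelianVariety)
open Literature.AlgebraicGeometry.Motives.AbelianVariety
open Literature.NumberTheory.ComplexMultiplication
open Literature.AlgebraicGeometry.HodgeTheory
open Literature.AlgebraicGeometry.Pohlmann1968 Literature.AlgebraicGeometry.Pohlmann1968.Cyclotomic
open CyclotomicCMTypeResidueSets (IsCMResidueSet unitResidues residueSet residueSet_cmTypeOfResidues isCMResidueSet_residueSet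
  autResidue autResidue_spec exists_autResidue_eq)

/-! ## §0 Helpers at any level -/

section General

variable {N : ℕ} [NeZero N]

/-- **`−1 ∉ W`**: the residue stabiliser of a CM residue set never contains `−1` (`−S = S` contradicts `c ∈ S ⟺ −c ∉ S`).
[cite: Shimura1998, §8.4 Example (1)] -/
theorem neg_one_notMem_stabilizerResidues {S : Finset (ZMod N)} (hS : IsCMResidueSet N S) :
    (-1 : ZMod N) ∉ (unitResidues N).filter fun t => ∀ c ∈ unitResidues N, (c * t ∈ S ↔ c ∈ S) := by
  intro h
  have h1 : (1 : ZMod N) ∈ unitResidues N := (mem_unitResidues_iff_isUnit 1).2 isUnit_one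
  have hcm := hS.2 1 h1
  have hstab := (Finset.mem_filter.1 h).2 1 h1
  rw [one_mul] at hstab
  exact iff_not_self (hcm.trans (not_congr hstab))

/-- At a level with `φ(N) = 4`: if `W ∋ t ≠ 1` then `W = {1, t}` (`2|W| ≤ φ(N)`). [cite: BauerCosteItzyksonRuelle1997, §3.4] -/
theorem stabilizerResidues_eq_pair_of_mem {S : Finset (ZMod N)} (hS : IsCMResidueSet N S) (hφ : N.totient = 4) {t : ZMod N}
    (ht : t ∈ (unitResidues N).filter fun t => ∀ c ∈ unitResidues N, (c * t ∈ S ↔ c ∈ S)) (ht1 : t ≠ 1) :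
    ((unitResidues N).filter fun t => ∀ c ∈ unitResidues N, (c * t ∈ S ↔ c ∈ S)) = {1, t} := by
  have hle := two_mul_card_stabilizerResidues_le_totient hS
  rw [hφ] at hle
  have h1 : (1 : ZMod N) ∈ (unitResidues N).filter fun t => ∀ c ∈ unitResidues N, (c * t ∈ S ↔ c ∈ S) :=
    Finset.mem_filter.2 ⟨(mem_unitResidues_iff_isUnit 1).2 isUnit_one, fun c _ => by rw [mul_one]⟩
  symm
  apply Finset.eq_of_subset_of_card_le
  · intro x hx
    rcases Finset.mem_insert.1 hx with rfl | hx
    · exact h1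
    · rw [Finset.mem_singleton.1 hx]
      exact ht
  · rw [Finset.card_pair ht1.symm]
    omega

variable {L : Type} [Field L] [NumberField L]

/-- A quadratic subfield containing a square root `δ` of a negative integer is `ℚ(δ)`. [folklore] -/
private theorem eq_adjoin_of_mem_of_sq_eq_neg {K₁ : IntermediateField ℚ L} {δ : L} (hδ : δ ∈ K₁) {m : ℕ} (hm : 0 < m)
    (hsq : δ ^ 2 = -(m : L)) (hdeg : Module.finrank ℚ K₁ = 2) : K₁ = IntermediateField.adjoin ℚ {δ} := by
  have hle : IntermediateField.adjoin ℚ {δ} ≤ K₁ := IntermediateField.adjoin_simple_le_iff.2 hδ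
  have hne : Module.finrank ℚ (IntermediateField.adjoin ℚ {δ}) ≠ 1 := by
    intro h1
    rw [IntermediateField.finrank_eq_one_iff, IntermediateField.adjoin_simple_eq_bot_iff, IntermediateField.mem_bot] at h1
    obtain ⟨q, hq⟩ := h1
    have hq2 : (algebraMap ℚ L) (q ^ 2) = (algebraMap ℚ L) (-(m : ℚ)) := by
      rw [map_pow, hq, hsq, map_neg, map_natCast]
    have hq2' : q ^ 2 = -(m : ℚ) := (algebraMap ℚ L).injective hq2
    have hm' : (0 : ℚ) < m := by exact_mod_cast hm
    nlinarith [sq_nonneg q]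
  haveI : FiniteDimensional ℚ K₁ := inferInstance
  have hdvd : Module.finrank ℚ (IntermediateField.adjoin ℚ {δ}) ∣ 2 := hdeg ▸ IntermediateField.finrank_dvd_of_le_right hle
  have h2 : Module.finrank ℚ (IntermediateField.adjoin ℚ {δ}) = 2 := by
    rcases (Nat.dvd_prime Nat.prime_two).1 hdvd with h | h
    · exact absurd h hne
    · exact h
  exact (IntermediateField.eq_of_le_of_finrank_eq hle (h2.trans hdeg.symm)).symm

variable [IsCyclotomicExtension {N} ℚ L]

/-- `[K₁ : ℚ] = 2` when `φ(N) = 4` and `|W| = 2` (`[ℚ(ζ_N) : K₁] = |W|`). [cite: KoblitzRohrlich1978, §1 p. 1184] -/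
theorem finrank_eq_two_of_primitive_of_card_eq_two (hφ : N.totient = 4) (Φ : CMType L) {K₁ : IntermediateField ℚ L}
    (Φ₁ : CMType K₁) (h₁ : inducedCMType (algebraMap K₁ L) Φ₁ = Φ)
    (hp₁ : ∀ s t : K₁ →+* ℂ,
      (∀ τ : ℂ ≃+* ℂ, (τ : ℂ →+* ℂ).comp s ∈ Φ₁.1 ↔ (τ : ℂ →+* ℂ).comp t ∈ Φ₁.1) → s = t)
    (h2 : ((unitResidues N).filter fun t =>
        ∀ c ∈ unitResidues N, (c * t ∈ residueSet N Φ ↔ c ∈ residueSet N Φ)).card = 2) :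
    Module.finrank ℚ K₁ = 2 := by
  have hmul := Module.finrank_mul_finrank ℚ K₁ L
  rw [finrank_eq_card_filter_of_primitive (N := N) Φ Φ₁ h₁ hp₁, h2, finrank_eq_totient N L, hφ] at hmul
  omega

/-- `K₁ = L^{σ_t}` and `δ ∈ K₁` when `W = {1, t}` and `σ_t δ = δ`. [cite: KoblitzRohrlich1978, §1 p. 1184] [cite: Shimura1998, §8.2 Prop. 26] -/
theorem mem_of_stabilizerResidues_eq_pair (Φ : CMType L) {K₁ : IntermediateField ℚ L} (Φ₁ : CMType K₁)
    (h₁ : inducedCMType (algebraMap K₁ L) Φ₁ = Φ)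
    (hp₁ : ∀ s t : K₁ →+* ℂ,
      (∀ τ : ℂ ≃+* ℂ, (τ : ℂ →+* ℂ).comp s ∈ Φ₁.1 ↔ (τ : ℂ →+* ℂ).comp t ∈ Φ₁.1) → s = t) {t : ZMod N}
    (hW : ((unitResidues N).filter fun t =>
        ∀ c ∈ unitResidues N, (c * t ∈ residueSet N Φ ↔ c ∈ residueSet N Φ)) = {1, t})
    {σ : L ≃ₐ[ℚ] L} (hσ : autResidue N L σ = t) {δ : L} (hfix : σ δ = δ) : δ ∈ K₁ := by
  refine (mem_iff_apply_eq_of_primitive_of_forall_exists_pow (N := N) Φ Φ₁ h₁ hp₁ ?_ ?_ δ).2 hfix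
  · rw [hW, hσ]
    simp
  · intro u hu
    rw [hW, Finset.mem_insert, Finset.mem_singleton] at hu
    rcases hu with h | h
    · exact ⟨0, by rw [h, pow_zero]⟩
    · exact ⟨1, by rw [h, hσ, pow_one]⟩

/-- The decomposition `A ∼ E × E` with `E` elliptic, CM by `𝓞_{K₁}`, for a CM type of `ℚ(ζ_N)` with `φ(N) = 4` and `|W| = 2` (gen 14's
`A ∼ B^{|W|}`, `2 dim B · |W| = φ(N)`). [cite: KoblitzRohrlich1978, §1 p. 1184] [cite: Shimura1998, §8.2 Prop. 26, §6.2 Thm. 3]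
[cite: BauerCosteItzyksonRuelle1997, §3.4] -/
theorem exists_isIsogeny_sq_elliptic_of_card_eq_two [IsCMField L] (hφ : N.totient = 4) {Φ : CMType L} {A : AbelianVariety ℂ}
    {ι : 𝓞 L →+* End A} {θ : L →+* Module.End ℂ (complexBetti A.X 1)} (hA : IsCMTypeRealisation Φ A ι θ)
    (h2 : ((unitResidues N).filter fun t =>
        ∀ c ∈ unitResidues N, (c * t ∈ residueSet N Φ ↔ c ∈ residueSet N Φ)).card = 2) :
    ∃ (K₁ : IntermediateField ℚ L) (Φ₁ : CMType K₁), IsCMField K₁ ∧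
      inducedCMType (algebraMap K₁ L) Φ₁ = Φ ∧
      (∀ s t : K₁ →+* ℂ,
        (∀ τ : ℂ ≃+* ℂ, (τ : ℂ →+* ℂ).comp s ∈ Φ₁.1 ↔ (τ : ℂ →+* ℂ).comp t ∈ Φ₁.1) → s = t) ∧
      Module.finrank ℚ K₁ = 2 ∧ A.dim = 2 ∧
      ∃ (E : AbelianVariety ℂ) (ιE : 𝓞 K₁ →+* End E) (θE : K₁ →+* Module.End ℂ (complexBetti E.X 1)),
        IsCMTypeRealisation Φ₁ E ιE θE ∧ E.dim = 1 ∧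
        ∃ (P : AbelianVariety ℂ) (π : Fin 2 → (P ⟶ E)), Nonempty (IsLimit (Fan.mk P π)) ∧
          ∃ g : A ⟶ P, IsIsogeny g ∧
            ∀ j (b : 𝓞 K₁), ι (RingOfIntegers.mapRingHom (algebraMap K₁ L : K₁ →+* L) b) ≫ (g ≫ π j) =
              (g ≫ π j) ≫ ιE b := by
  have H := exists_isIsogeny_power_simple_cyclotomic (N := N) hA
  rw [h2] at H
  obtain ⟨K₁, Φ₁, hCM, h₁, hp₁, -, E, ιE, θE, hE, -, hdim, P, π, hP, g, hg, hequiv⟩ := H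
  have hdA := dim_eq_of_realisation (N := N) hA
  rw [hφ] at hdA
  exact ⟨K₁, Φ₁, hCM, h₁, hp₁, finrank_eq_two_of_primitive_of_card_eq_two hφ Φ Φ₁ h₁ hp₁ h2, hdA, E, ιE, θE, hE, by omega,
    P, π, hP, g, hg, hequiv⟩

end General

/-! ## §1 Level `8`: `ℚ(√−2) = ℚ(ζ₈ + ζ₈³)` and `ℚ(i) = ℚ(ζ₈²)` -/

section Eight

variable {L : Type} [Field L] [NumberField L] [IsCyclotomicExtension {8} ℚ L]

/-- `ζ₈⁴ = −1`. [folklore] -/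
private theorem zetaOf_pow_four_eight : zetaOf 8 L ^ 4 = -1 :=
  ((IsCyclotomicExtension.zeta_spec 8 ℚ L).pow (by norm_num) (show 8 = 4 * 2 by norm_num)).eq_neg_one_of_two_right

/-- **`(ζ₈ + ζ₈³)² = −2`**: `ζ₈ + ζ₈³` is a square root of `−2` in `ℚ(ζ₈)`. [cite: BauerCosteItzyksonRuelle1997, §3.4] -/
theorem sq_zetaOf_add_pow_three_eight : (zetaOf 8 L + zetaOf 8 L ^ 3) ^ 2 = -2 := by
  linear_combination (zetaOf 8 L ^ 2 + 2) * zetaOf_pow_four_eight (L := L)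

/-- **`(ζ₈²)² = −1`**: `ζ₈² = i`. [cite: BauerCosteItzyksonRuelle1997, §3.4] -/
theorem sq_zetaOf_sq_eight : (zetaOf 8 L ^ 2) ^ 2 = -1 := by
  rw [← pow_mul]
  exact zetaOf_pow_four_eight

/-- `(ℤ/8)ˣ = {1, 3, 5, 7}`. [folklore] -/
private theorem unitResidues_eight : unitResidues 8 = {1, 3, 5, 7} := by decide

/-- **«For `n = 8`, `H_{r,s,t}` can only be `{1,3}` or `{1,5}`»**: the residue stabiliser of EVERY CM residue set modulo `8` is `{1, 3}`
or `{1, 5}` (`|W| = 2` at the good level `8`; `−1 = 7 ∉ W`). [cite: BauerCosteItzyksonRuelle1997, §3.4] -/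
theorem stabilizerResidues_eq_or_eight {S : Finset (ZMod 8)} (hS : IsCMResidueSet 8 S) :
    ((unitResidues 8).filter fun t => ∀ c ∈ unitResidues 8, (c * t ∈ S ↔ c ∈ S)) = {1, 3} ∨
      ((unitResidues 8).filter fun t => ∀ c ∈ unitResidues 8, (c * t ∈ S ↔ c ∈ S)) = {1, 5} := by
  have hφ : Nat.totient 8 = 4 := by decide
  have h2 : ((unitResidues 8).filter fun t => ∀ c ∈ unitResidues 8, (c * t ∈ S ↔ c ∈ S)).card = 2 := by
    have h := CyclotomicFermatCMType.two_mul_card_stabilizerResidues_eq_totient_of_goodLevel (n := 8) (by norm_num) hS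
    omega
  obtain ⟨x, y, hxy, hW⟩ := Finset.card_eq_two.1 h2
  have h1 : (1 : ZMod 8) ∈ (unitResidues 8).filter fun t => ∀ c ∈ unitResidues 8, (c * t ∈ S ↔ c ∈ S) :=
    Finset.mem_filter.2 ⟨by decide, fun c _ => by rw [mul_one]⟩
  have hm1 := neg_one_notMem_stabilizerResidues hS
  -- a member `t ≠ 1` of `W`
  obtain ⟨t, ht, ht1⟩ : ∃ t, t ∈ ((unitResidues 8).filter fun t => ∀ c ∈ unitResidues 8, (c * t ∈ S ↔ c ∈ S)) ∧ t ≠ 1 := by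
    rw [hW, Finset.mem_insert, Finset.mem_singleton] at h1
    rcases h1 with h | h
    · exact ⟨y, by rw [hW]; simp, fun hy => hxy (h.symm.trans hy.symm)⟩
    · exact ⟨x, by rw [hW]; simp, fun hx => hxy (hx.trans h)⟩
  have hpair := stabilizerResidues_eq_pair_of_mem hS hφ ht ht1
  have htU : t ∈ unitResidues 8 := (Finset.mem_filter.1 ht).1
  have ht7 : t ≠ 7 := by
    intro h7
    rw [h7] at ht
    rw [show (-1 : ZMod 8) = 7 from by decide] at hm1
    exact hm1 ht
  rw [unitResidues_eight] at htU
  simp only [Finset.mem_insert, Finset.mem_singleton] at htU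
  rcases htU with h | h | h | h
  · exact absurd h ht1
  · left; rw [hpair, h]
  · right; rw [hpair, h]
  · exact absurd h ht7

/-- At level `8` a CM residue set containing `1` IS its stabiliser (`H = W`, «`H` is a group»). [cite: BauerCosteItzyksonRuelle1997, §3.4] -/
theorem eq_stabilizerResidues_of_one_mem_eight {S : Finset (ZMod 8)} (hS : IsCMResidueSet 8 S) (h1 : (1 : ZMod 8) ∈ S) :
    S = (unitResidues 8).filter fun t => ∀ c ∈ unitResidues 8, (c * t ∈ S ↔ c ∈ S) := by
  have hsub : ((unitResidues 8).filter fun t => ∀ c ∈ unitResidues 8, (c * t ∈ S ↔ c ∈ S)) ⊆ S := fun t ht => by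
    simpa using mul_mem_of_mem_stabilizerResidues hS h1 ht
  have hcard : S.card ≤ ((unitResidues 8).filter fun t => ∀ c ∈ unitResidues 8, (c * t ∈ S ↔ c ∈ S)).card := by
    have h := CyclotomicFermatCMType.two_mul_card_stabilizerResidues_eq_totient_of_goodLevel (n := 8) (by norm_num) hS
    have hS2 := CyclotomicCMTypeResidueSets.two_mul_card_eq_card_unitResidues hS
    rw [CyclotomicCMTypeResidueSets.card_unitResidues] at hS2
    omega
  exact (Finset.eq_of_subset_of_card_le hsub hcard).symm

/-- `σ_3 (ζ₈ + ζ₈³) = ζ₈³ + ζ₈⁹ = ζ₈ + ζ₈³`. [cite: Washington1997, Thm. 2.5] -/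
theorem apply_sqrt_neg_two_eight {σ : L ≃ₐ[ℚ] L} (hσ : autResidue 8 L σ = 3) :
    σ (zetaOf 8 L + zetaOf 8 L ^ 3) = zetaOf 8 L + zetaOf 8 L ^ 3 := by
  have h1 : σ (zetaOf 8 L) = zetaOf 8 L ^ 3 := by
    rw [autResidue_spec 8 σ, hσ]
    rfl
  have h8 : zetaOf 8 L ^ 8 = 1 := (IsCyclotomicExtension.zeta_spec 8 ℚ L).pow_eq_one
  rw [map_add, map_pow, h1, ← pow_mul]
  linear_combination zetaOf 8 L * h8

/-- `σ_5 (ζ₈²) = ζ₈^{10} = ζ₈²`. [cite: Washington1997, Thm. 2.5] -/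
theorem apply_sqrt_neg_one_eight {σ : L ≃ₐ[ℚ] L} (hσ : autResidue 8 L σ = 5) : σ (zetaOf 8 L ^ 2) = zetaOf 8 L ^ 2 := by
  have h1 : σ (zetaOf 8 L) = zetaOf 8 L ^ 5 := by
    rw [autResidue_spec 8 σ, hσ]
    rfl
  have h8 : zetaOf 8 L ^ 8 = 1 := (IsCyclotomicExtension.zeta_spec 8 ℚ L).pow_eq_one
  rw [map_pow, h1, ← pow_mul]
  linear_combination zetaOf 8 L ^ 2 * h8

/-- **«`K = ℚ(√−2)` if `H_{r,s,t} = {1,3}`»**, for every CM type of `ℚ(ζ₈)`: if `3 ∈ W` then the field of ANY primitive sub-pair is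
`K₁ = ℚ(ζ₈ + ζ₈³)` (`(ζ₈ + ζ₈³)² = −2`), a quadratic field. [cite: BauerCosteItzyksonRuelle1997, §3.4] [cite: KoblitzRohrlich1978, §1 p. 1184] -/
theorem eq_adjoin_sqrt_neg_two_of_three_mem_eight (Φ : CMType L) {K₁ : IntermediateField ℚ L} (Φ₁ : CMType K₁)
    (h₁ : inducedCMType (algebraMap K₁ L) Φ₁ = Φ)
    (hp₁ : ∀ s t : K₁ →+* ℂ,
      (∀ τ : ℂ ≃+* ℂ, (τ : ℂ →+* ℂ).comp s ∈ Φ₁.1 ↔ (τ : ℂ →+* ℂ).comp t ∈ Φ₁.1) → s = t)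
    (h3 : (3 : ZMod 8) ∈ (unitResidues 8).filter fun t =>
        ∀ c ∈ unitResidues 8, (c * t ∈ residueSet 8 Φ ↔ c ∈ residueSet 8 Φ)) :
    zetaOf 8 L + zetaOf 8 L ^ 3 ∈ K₁ ∧ K₁ = IntermediateField.adjoin ℚ {zetaOf 8 L + zetaOf 8 L ^ 3} ∧
      Module.finrank ℚ K₁ = 2 := by
  have hφ : Nat.totient 8 = 4 := by decide
  have hW := stabilizerResidues_eq_pair_of_mem (isCMResidueSet_residueSet 8 Φ) hφ h3 (by decide)
  obtain ⟨σ, hσ⟩ := exists_autResidue_eq 8 (L := L) 3 (by decide)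
  have hmem := mem_of_stabilizerResidues_eq_pair (N := 8) Φ Φ₁ h₁ hp₁ hW hσ (apply_sqrt_neg_two_eight hσ)
  have h2 : ((unitResidues 8).filter fun t =>
      ∀ c ∈ unitResidues 8, (c * t ∈ residueSet 8 Φ ↔ c ∈ residueSet 8 Φ)).card = 2 := by
    rw [hW]
    decide
  have hdeg := finrank_eq_two_of_primitive_of_card_eq_two hφ Φ Φ₁ h₁ hp₁ h2
  exact ⟨hmem, eq_adjoin_of_mem_of_sq_eq_neg hmem (m := 2) (by norm_num)
    (by rw [sq_zetaOf_add_pow_three_eight]; norm_num) hdeg, hdeg⟩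

/-- **«`K = ℚ(i)` if `H_{r,s,t} = {1,5}`»**: if `5 ∈ W` then `K₁ = ℚ(ζ₈²)` (`(ζ₈²)² = −1`), quadratic. [cite: BauerCosteItzyksonRuelle1997, §3.4]
[cite: KoblitzRohrlich1978, §1 p. 1184] -/
theorem eq_adjoin_sqrt_neg_one_of_five_mem_eight (Φ : CMType L) {K₁ : IntermediateField ℚ L} (Φ₁ : CMType K₁)
    (h₁ : inducedCMType (algebraMap K₁ L) Φ₁ = Φ)
    (hp₁ : ∀ s t : K₁ →+* ℂ,
      (∀ τ : ℂ ≃+* ℂ, (τ : ℂ →+* ℂ).comp s ∈ Φ₁.1 ↔ (τ : ℂ →+* ℂ).comp t ∈ Φ₁.1) → s = t)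
    (h5 : (5 : ZMod 8) ∈ (unitResidues 8).filter fun t =>
        ∀ c ∈ unitResidues 8, (c * t ∈ residueSet 8 Φ ↔ c ∈ residueSet 8 Φ)) :
    zetaOf 8 L ^ 2 ∈ K₁ ∧ K₁ = IntermediateField.adjoin ℚ {zetaOf 8 L ^ 2} ∧ Module.finrank ℚ K₁ = 2 := by
  have hφ : Nat.totient 8 = 4 := by decide
  have hW := stabilizerResidues_eq_pair_of_mem (isCMResidueSet_residueSet 8 Φ) hφ h5 (by decide)
  obtain ⟨σ, hσ⟩ := exists_autResidue_eq 8 (L := L) 5 (by decide)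
  have hmem := mem_of_stabilizerResidues_eq_pair (N := 8) Φ Φ₁ h₁ hp₁ hW hσ (apply_sqrt_neg_one_eight hσ)
  have h2 : ((unitResidues 8).filter fun t =>
      ∀ c ∈ unitResidues 8, (c * t ∈ residueSet 8 Φ ↔ c ∈ residueSet 8 Φ)).card = 2 := by
    rw [hW]
    decide
  have hdeg := finrank_eq_two_of_primitive_of_card_eq_two hφ Φ Φ₁ h₁ hp₁ h2
  exact ⟨hmem, eq_adjoin_of_mem_of_sq_eq_neg hmem (m := 1) (by norm_num) (by rw [sq_zetaOf_sq_eight]; norm_num) hdeg, hdeg⟩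

variable {Φ : CMType L} {A : AbelianVariety ℂ} {ι : 𝓞 L →+* End A} {θ : L →+* Module.End ℂ (complexBetti A.X 1)}

/-- **LEVEL `8`, «`K = ℚ(√−2)`» ON ABELIAN SURFACES.**  Every abelian variety `A` of a CM type `Φ` of `ℚ(ζ₈)` with `3 ∈ W` is an abelian
SURFACE `𝓞_{K₁}`-equivariantly isogenous to `E × E`, `E` an ELLIPTIC CURVE with complex multiplication `𝓞_{K₁} → End E` by the quadratic
field `K₁ = ℚ(ζ₈ + ζ₈³)`, `(ζ₈ + ζ₈³)² = −2` (BCIR's `L ∼ [ℤ(√−2)]²`). [cite: BauerCosteItzyksonRuelle1997, §3.4]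
[cite: KoblitzRohrlich1978, §1 p. 1184] [cite: Shimura1998, §8.2 Prop. 26, §6.2 Thm. 3] -/
theorem exists_isIsogeny_sq_elliptic_eight_of_three_mem (hA : IsCMTypeRealisation Φ A ι θ)
    (h3 : (3 : ZMod 8) ∈ (unitResidues 8).filter fun t =>
        ∀ c ∈ unitResidues 8, (c * t ∈ residueSet 8 Φ ↔ c ∈ residueSet 8 Φ)) :
    ∃ (K₁ : IntermediateField ℚ L) (Φ₁ : CMType K₁), IsCMField K₁ ∧
      zetaOf 8 L + zetaOf 8 L ^ 3 ∈ K₁ ∧ K₁ = IntermediateField.adjoin ℚ {zetaOf 8 L + zetaOf 8 L ^ 3} ∧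
      (zetaOf 8 L + zetaOf 8 L ^ 3) ^ 2 = -2 ∧ Module.finrank ℚ K₁ = 2 ∧ A.dim = 2 ∧
      inducedCMType (algebraMap K₁ L) Φ₁ = Φ ∧
      ∃ (E : AbelianVariety ℂ) (ιE : 𝓞 K₁ →+* End E) (θE : K₁ →+* Module.End ℂ (complexBetti E.X 1)),
        IsCMTypeRealisation Φ₁ E ιE θE ∧ E.dim = 1 ∧
        ∃ (P : AbelianVariety ℂ) (π : Fin 2 → (P ⟶ E)), Nonempty (IsLimit (Fan.mk P π)) ∧
          ∃ g : A ⟶ P, IsIsogeny g ∧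
            ∀ j (b : 𝓞 K₁), ι (RingOfIntegers.mapRingHom (algebraMap K₁ L : K₁ →+* L) b) ≫ (g ≫ π j) =
              (g ≫ π j) ≫ ιE b := by
  haveI : IsCMField L := IsCyclotomicExtension.Rat.isCMField L (S := {8}) ⟨8, rfl, by norm_num⟩
  have hφ : Nat.totient 8 = 4 := by decide
  have hW := stabilizerResidues_eq_pair_of_mem (isCMResidueSet_residueSet 8 Φ) hφ h3 (by decide)
  have h2 : ((unitResidues 8).filter fun t =>
      ∀ c ∈ unitResidues 8, (c * t ∈ residueSet 8 Φ ↔ c ∈ residueSet 8 Φ)).card = 2 := by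
    rw [hW]
    decide
  obtain ⟨K₁, Φ₁, hCM, h₁, hp₁, hdeg, hdA, E, ιE, θE, hE, hdE, P, π, hP, g, hg, hequiv⟩ :=
    exists_isIsogeny_sq_elliptic_of_card_eq_two (N := 8) hφ hA h2
  obtain ⟨hmem, hK, -⟩ := eq_adjoin_sqrt_neg_two_of_three_mem_eight Φ Φ₁ h₁ hp₁ h3
  exact ⟨K₁, Φ₁, hCM, hmem, hK, sq_zetaOf_add_pow_three_eight, hdeg, hdA, h₁, E, ιE, θE, hE, hdE, P, π, hP, g, hg, hequiv⟩

/-- **LEVEL `8`, «`K = ℚ(i)`» ON ABELIAN SURFACES**: `5 ∈ W` ⟹ `A ∼ E × E`, `E` elliptic with CM by `𝓞_{K₁}`, `K₁ = ℚ(ζ₈²)`, `(ζ₈²)² = −1`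
(BCIR's `[ℤ(i)]²`). [cite: BauerCosteItzyksonRuelle1997, §3.4] [cite: KoblitzRohrlich1978, §1 p. 1184] [cite: Shimura1998, §8.2 Prop. 26, §6.2 Thm. 3] -/
theorem exists_isIsogeny_sq_elliptic_eight_of_five_mem (hA : IsCMTypeRealisation Φ A ι θ)
    (h5 : (5 : ZMod 8) ∈ (unitResidues 8).filter fun t =>
        ∀ c ∈ unitResidues 8, (c * t ∈ residueSet 8 Φ ↔ c ∈ residueSet 8 Φ)) :
    ∃ (K₁ : IntermediateField ℚ L) (Φ₁ : CMType K₁), IsCMField K₁ ∧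
      zetaOf 8 L ^ 2 ∈ K₁ ∧ K₁ = IntermediateField.adjoin ℚ {zetaOf 8 L ^ 2} ∧
      (zetaOf 8 L ^ 2) ^ 2 = -1 ∧ Module.finrank ℚ K₁ = 2 ∧ A.dim = 2 ∧
      inducedCMType (algebraMap K₁ L) Φ₁ = Φ ∧
      ∃ (E : AbelianVariety ℂ) (ιE : 𝓞 K₁ →+* End E) (θE : K₁ →+* Module.End ℂ (complexBetti E.X 1)),
        IsCMTypeRealisation Φ₁ E ιE θE ∧ E.dim = 1 ∧
        ∃ (P : AbelianVariety ℂ) (π : Fin 2 → (P ⟶ E)), Nonempty (IsLimit (Fan.mk P π)) ∧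
          ∃ g : A ⟶ P, IsIsogeny g ∧
            ∀ j (b : 𝓞 K₁), ι (RingOfIntegers.mapRingHom (algebraMap K₁ L : K₁ →+* L) b) ≫ (g ≫ π j) =
              (g ≫ π j) ≫ ιE b := by
  haveI : IsCMField L := IsCyclotomicExtension.Rat.isCMField L (S := {8}) ⟨8, rfl, by norm_num⟩
  have hφ : Nat.totient 8 = 4 := by decide
  have hW := stabilizerResidues_eq_pair_of_mem (isCMResidueSet_residueSet 8 Φ) hφ h5 (by decide)
  have h2 : ((unitResidues 8).filter fun t =>
      ∀ c ∈ unitResidues 8, (c * t ∈ residueSet 8 Φ ↔ c ∈ residueSet 8 Φ)).card = 2 := by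
    rw [hW]
    decide
  obtain ⟨K₁, Φ₁, hCM, h₁, hp₁, hdeg, hdA, E, ιE, θE, hE, hdE, P, π, hP, g, hg, hequiv⟩ :=
    exists_isIsogeny_sq_elliptic_of_card_eq_two (N := 8) hφ hA h2
  obtain ⟨hmem, hK, -⟩ := eq_adjoin_sqrt_neg_one_of_five_mem_eight Φ Φ₁ h₁ hp₁ h5
  exact ⟨K₁, Φ₁, hCM, hmem, hK, sq_zetaOf_sq_eight, hdeg, hdA, h₁, E, ιE, θE, hE, hdE, P, π, hP, g, hg, hequiv⟩

/-- **Level `8`, every CM type**: every abelian variety with complex multiplication by `ℚ(ζ₈)` is a surface isogenous to `E × E` with `E`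
an elliptic curve with complex multiplication by `ℚ(√−2) = ℚ(ζ₈ + ζ₈³)` or by `ℚ(i) = ℚ(ζ₈²)`. [cite: BauerCosteItzyksonRuelle1997, §3.4] -/
theorem exists_isIsogeny_sq_elliptic_eight (hA : IsCMTypeRealisation Φ A ι θ) :
    ∃ (K₁ : IntermediateField ℚ L) (Φ₁ : CMType K₁) (δ : L), IsCMField K₁ ∧ δ ∈ K₁ ∧
      K₁ = IntermediateField.adjoin ℚ {δ} ∧ (δ ^ 2 = -2 ∨ δ ^ 2 = -1) ∧ Module.finrank ℚ K₁ = 2 ∧ A.dim = 2 ∧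
      inducedCMType (algebraMap K₁ L) Φ₁ = Φ ∧
      ∃ (E : AbelianVariety ℂ) (ιE : 𝓞 K₁ →+* End E) (θE : K₁ →+* Module.End ℂ (complexBetti E.X 1)),
        IsCMTypeRealisation Φ₁ E ιE θE ∧ E.dim = 1 ∧
        ∃ (P : AbelianVariety ℂ) (π : Fin 2 → (P ⟶ E)), Nonempty (IsLimit (Fan.mk P π)) ∧ ∃ g : A ⟶ P, IsIsogeny g := by
  rcases stabilizerResidues_eq_or_eight (isCMResidueSet_residueSet 8 Φ) with hW | hW
  · have h3 : (3 : ZMod 8) ∈ (unitResidues 8).filter fun t =>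
        ∀ c ∈ unitResidues 8, (c * t ∈ residueSet 8 Φ ↔ c ∈ residueSet 8 Φ) := by
      rw [hW]; simp
    obtain ⟨K₁, Φ₁, hCM, hmem, hK, hsq, hdeg, hdA, h₁, E, ιE, θE, hE, hdE, P, π, hP, g, hg, -⟩ :=
      exists_isIsogeny_sq_elliptic_eight_of_three_mem hA h3
    exact ⟨K₁, Φ₁, _, hCM, hmem, hK, Or.inl hsq, hdeg, hdA, h₁, E, ιE, θE, hE, hdE, P, π, hP, g, hg⟩
  · have h5 : (5 : ZMod 8) ∈ (unitResidues 8).filter fun t =>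
        ∀ c ∈ unitResidues 8, (c * t ∈ residueSet 8 Φ ↔ c ∈ residueSet 8 Φ) := by
      rw [hW]; simp
    obtain ⟨K₁, Φ₁, hCM, hmem, hK, hsq, hdeg, hdA, h₁, E, ιE, θE, hE, hdE, P, π, hP, g, hg, -⟩ :=
      exists_isIsogeny_sq_elliptic_eight_of_five_mem hA h5
    exact ⟨K₁, Φ₁, _, hCM, hmem, hK, Or.inr hsq, hdeg, hdA, h₁, E, ιE, θE, hE, hdE, P, π, hP, g, hg⟩

end Eight

/-! ## §2 Level `12`: `ℚ(i) = ℚ(ζ₁₂³)` and `ℚ(ω) = ℚ(√−3) = ℚ(1 + 2ζ₁₂⁴)` -/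

section Twelve

variable {L : Type} [Field L] [NumberField L] [IsCyclotomicExtension {12} ℚ L]

/-- `ζ₁₂⁶ = −1`. [folklore] -/
private theorem zetaOf_pow_six_twelve : zetaOf 12 L ^ 6 = -1 :=
  ((IsCyclotomicExtension.zeta_spec 12 ℚ L).pow (by norm_num) (show 12 = 6 * 2 by norm_num)).eq_neg_one_of_two_right

/-- **`(ζ₁₂³)² = −1`**: `ζ₁₂³ = i`. [cite: BauerCosteItzyksonRuelle1997, §3.4] -/
theorem sq_zetaOf_pow_three_twelve : (zetaOf 12 L ^ 3) ^ 2 = -1 := by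
  rw [← pow_mul]
  exact zetaOf_pow_six_twelve

/-- **`ω² + ω + 1 = 0` for `ω = ζ₁₂⁴`** (a primitive cube root of unity). [cite: BauerCosteItzyksonRuelle1997, §3.4] -/
theorem omega_sq_add_omega_add_one_twelve : (zetaOf 12 L ^ 4) ^ 2 + zetaOf 12 L ^ 4 + 1 = 0 := by
  have hω : IsPrimitiveRoot (zetaOf 12 L ^ 4) 3 :=
    (IsCyclotomicExtension.zeta_spec 12 ℚ L).pow (by norm_num) (show 12 = 4 * 3 by norm_num)
  have h := hω.geom_sum_eq_zero (by norm_num)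
  simp only [Finset.sum_range_succ, Finset.sum_range_zero, pow_zero, pow_one, zero_add] at h
  linear_combination h

/-- **`(1 + 2ω)² = −3`**: `1 + 2ζ₁₂⁴` is a square root of `−3`, so `ℚ(ω) = ℚ(√−3)`. [cite: BauerCosteItzyksonRuelle1997, §3.4] -/
theorem sq_one_add_two_omega_twelve : (1 + 2 * zetaOf 12 L ^ 4) ^ 2 = -3 := by
  linear_combination 4 * omega_sq_add_omega_add_one_twelve (L := L)

/-- `(ℤ/12)ˣ = {1, 5, 7, 11}`. [folklore] -/
private theorem unitResidues_twelve : unitResidues 12 = {1, 5, 7, 11} := by decide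

/-- **«for `n = 12`, a set `H_{r,s,t}` of order 2 can only be `{1,5}` or `{1,7}`»**: the residue stabiliser of EVERY CM residue set modulo
`12` is `{1, 5}` or `{1, 7}`. [cite: BauerCosteItzyksonRuelle1997, §3.4] -/
theorem stabilizerResidues_eq_or_twelve {S : Finset (ZMod 12)} (hS : IsCMResidueSet 12 S) :
    ((unitResidues 12).filter fun t => ∀ c ∈ unitResidues 12, (c * t ∈ S ↔ c ∈ S)) = {1, 5} ∨
      ((unitResidues 12).filter fun t => ∀ c ∈ unitResidues 12, (c * t ∈ S ↔ c ∈ S)) = {1, 7} := by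
  have hφ : Nat.totient 12 = 4 := by decide
  have h2 : ((unitResidues 12).filter fun t => ∀ c ∈ unitResidues 12, (c * t ∈ S ↔ c ∈ S)).card = 2 := by
    have h := CyclotomicFermatCMType.two_mul_card_stabilizerResidues_eq_totient_of_goodLevel (n := 12) (by norm_num) hS
    omega
  obtain ⟨x, y, hxy, hW⟩ := Finset.card_eq_two.1 h2
  have h1 : (1 : ZMod 12) ∈ (unitResidues 12).filter fun t => ∀ c ∈ unitResidues 12, (c * t ∈ S ↔ c ∈ S) :=
    Finset.mem_filter.2 ⟨by decide, fun c _ => by rw [mul_one]⟩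
  have hm1 := neg_one_notMem_stabilizerResidues hS
  obtain ⟨t, ht, ht1⟩ : ∃ t, t ∈ ((unitResidues 12).filter fun t => ∀ c ∈ unitResidues 12, (c * t ∈ S ↔ c ∈ S)) ∧ t ≠ 1 := by
    rw [hW, Finset.mem_insert, Finset.mem_singleton] at h1
    rcases h1 with h | h
    · exact ⟨y, by rw [hW]; simp, fun hy => hxy (h.symm.trans hy.symm)⟩
    · exact ⟨x, by rw [hW]; simp, fun hx => hxy (hx.trans h)⟩
  have hpair := stabilizerResidues_eq_pair_of_mem hS hφ ht ht1
  have htU : t ∈ unitResidues 12 := (Finset.mem_filter.1 ht).1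
  have ht11 : t ≠ 11 := by
    intro h11
    rw [h11] at ht
    rw [show (-1 : ZMod 12) = 11 from by decide] at hm1
    exact hm1 ht
  rw [unitResidues_twelve] at htU
  simp only [Finset.mem_insert, Finset.mem_singleton] at htU
  rcases htU with h | h | h | h
  · exact absurd h ht1
  · left; rw [hpair, h]
  · right; rw [hpair, h]
  · exact absurd h ht11

/-- At level `12` a CM residue set containing `1` IS its stabiliser (`H = W`). [cite: BauerCosteItzyksonRuelle1997, §3.4] -/
theorem eq_stabilizerResidues_of_one_mem_twelve {S : Finset (ZMod 12)} (hS : IsCMResidueSet 12 S) (h1 : (1 : ZMod 12) ∈ S) :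
    S = (unitResidues 12).filter fun t => ∀ c ∈ unitResidues 12, (c * t ∈ S ↔ c ∈ S) := by
  have hsub : ((unitResidues 12).filter fun t => ∀ c ∈ unitResidues 12, (c * t ∈ S ↔ c ∈ S)) ⊆ S := fun t ht => by
    simpa using mul_mem_of_mem_stabilizerResidues hS h1 ht
  have hcard : S.card ≤ ((unitResidues 12).filter fun t => ∀ c ∈ unitResidues 12, (c * t ∈ S ↔ c ∈ S)).card := by
    have h := CyclotomicFermatCMType.two_mul_card_stabilizerResidues_eq_totient_of_goodLevel (n := 12) (by norm_num) hS
    have hS2 := CyclotomicCMTypeResidueSets.two_mul_card_eq_card_unitResidues hS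
    rw [CyclotomicCMTypeResidueSets.card_unitResidues] at hS2
    omega
  exact (Finset.eq_of_subset_of_card_le hsub hcard).symm

/-- `σ_5 (ζ₁₂³) = ζ₁₂^{15} = ζ₁₂³`. [cite: Washington1997, Thm. 2.5] -/
theorem apply_sqrt_neg_one_twelve {σ : L ≃ₐ[ℚ] L} (hσ : autResidue 12 L σ = 5) : σ (zetaOf 12 L ^ 3) = zetaOf 12 L ^ 3 := by
  have h1 : σ (zetaOf 12 L) = zetaOf 12 L ^ 5 := by
    rw [autResidue_spec 12 σ, hσ]
    rfl
  have h12 : zetaOf 12 L ^ 12 = 1 := (IsCyclotomicExtension.zeta_spec 12 ℚ L).pow_eq_one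
  rw [map_pow, h1, ← pow_mul]
  linear_combination zetaOf 12 L ^ 3 * h12

/-- `σ_7 (ζ₁₂⁴) = ζ₁₂^{28} = ζ₁₂⁴`, hence `σ_7` fixes `1 + 2ζ₁₂⁴`. [cite: Washington1997, Thm. 2.5] -/
theorem apply_sqrt_neg_three_twelve {σ : L ≃ₐ[ℚ] L} (hσ : autResidue 12 L σ = 7) :
    σ (1 + 2 * zetaOf 12 L ^ 4) = 1 + 2 * zetaOf 12 L ^ 4 := by
  have h1 : σ (zetaOf 12 L) = zetaOf 12 L ^ 7 := by
    rw [autResidue_spec 12 σ, hσ]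
    rfl
  have h12 : zetaOf 12 L ^ 12 = 1 := (IsCyclotomicExtension.zeta_spec 12 ℚ L).pow_eq_one
  rw [map_add, map_one, map_mul, map_ofNat, map_pow, h1, ← pow_mul]
  linear_combination 2 * zetaOf 12 L ^ 4 * (zetaOf 12 L ^ 12 + 1) * h12

/-- **«`{1,5}` yielding `[ℤ(i)]²`»**: for every CM type of `ℚ(ζ₁₂)`, `5 ∈ W` ⟹ `K₁ = ℚ(ζ₁₂³)`, `(ζ₁₂³)² = −1`, quadratic.
[cite: BauerCosteItzyksonRuelle1997, §3.4] [cite: KoblitzRohrlich1978, §1 p. 1184] -/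
theorem eq_adjoin_sqrt_neg_one_of_five_mem_twelve (Φ : CMType L) {K₁ : IntermediateField ℚ L} (Φ₁ : CMType K₁)
    (h₁ : inducedCMType (algebraMap K₁ L) Φ₁ = Φ)
    (hp₁ : ∀ s t : K₁ →+* ℂ,
      (∀ τ : ℂ ≃+* ℂ, (τ : ℂ →+* ℂ).comp s ∈ Φ₁.1 ↔ (τ : ℂ →+* ℂ).comp t ∈ Φ₁.1) → s = t)
    (h5 : (5 : ZMod 12) ∈ (unitResidues 12).filter fun t =>
        ∀ c ∈ unitResidues 12, (c * t ∈ residueSet 12 Φ ↔ c ∈ residueSet 12 Φ)) :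
    zetaOf 12 L ^ 3 ∈ K₁ ∧ K₁ = IntermediateField.adjoin ℚ {zetaOf 12 L ^ 3} ∧ Module.finrank ℚ K₁ = 2 := by
  have hφ : Nat.totient 12 = 4 := by decide
  have hW := stabilizerResidues_eq_pair_of_mem (isCMResidueSet_residueSet 12 Φ) hφ h5 (by decide)
  obtain ⟨σ, hσ⟩ := exists_autResidue_eq 12 (L := L) 5 (by decide)
  have hmem := mem_of_stabilizerResidues_eq_pair (N := 12) Φ Φ₁ h₁ hp₁ hW hσ (apply_sqrt_neg_one_twelve hσ)
  have h2 : ((unitResidues 12).filter fun t =>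
      ∀ c ∈ unitResidues 12, (c * t ∈ residueSet 12 Φ ↔ c ∈ residueSet 12 Φ)).card = 2 := by
    rw [hW]
    decide
  have hdeg := finrank_eq_two_of_primitive_of_card_eq_two hφ Φ Φ₁ h₁ hp₁ h2
  exact ⟨hmem, eq_adjoin_of_mem_of_sq_eq_neg hmem (m := 1) (by norm_num) (by rw [sq_zetaOf_pow_three_twelve]; norm_num) hdeg,
    hdeg⟩

/-- **«`{1,7}` yielding `[ℤ(ω)]²`»**: `7 ∈ W` ⟹ `K₁ = ℚ(1 + 2ζ₁₂⁴) ∋ ζ₁₂⁴ = ω`, `(1 + 2ω)² = −3`, quadratic (`K₁ = ℚ(ω) = ℚ(√−3)`).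
[cite: BauerCosteItzyksonRuelle1997, §3.4] [cite: KoblitzRohrlich1978, §1 p. 1184] -/
theorem eq_adjoin_sqrt_neg_three_of_seven_mem_twelve (Φ : CMType L) {K₁ : IntermediateField ℚ L} (Φ₁ : CMType K₁)
    (h₁ : inducedCMType (algebraMap K₁ L) Φ₁ = Φ)
    (hp₁ : ∀ s t : K₁ →+* ℂ,
      (∀ τ : ℂ ≃+* ℂ, (τ : ℂ →+* ℂ).comp s ∈ Φ₁.1 ↔ (τ : ℂ →+* ℂ).comp t ∈ Φ₁.1) → s = t)
    (h7 : (7 : ZMod 12) ∈ (unitResidues 12).filter fun t =>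
        ∀ c ∈ unitResidues 12, (c * t ∈ residueSet 12 Φ ↔ c ∈ residueSet 12 Φ)) :
    1 + 2 * zetaOf 12 L ^ 4 ∈ K₁ ∧ zetaOf 12 L ^ 4 ∈ K₁ ∧ K₁ = IntermediateField.adjoin ℚ {1 + 2 * zetaOf 12 L ^ 4} ∧
      Module.finrank ℚ K₁ = 2 := by
  have hφ : Nat.totient 12 = 4 := by decide
  have hW := stabilizerResidues_eq_pair_of_mem (isCMResidueSet_residueSet 12 Φ) hφ h7 (by decide)
  obtain ⟨σ, hσ⟩ := exists_autResidue_eq 12 (L := L) 7 (by decide)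
  have hmem := mem_of_stabilizerResidues_eq_pair (N := 12) Φ Φ₁ h₁ hp₁ hW hσ (apply_sqrt_neg_three_twelve hσ)
  have hω : zetaOf 12 L ^ 4 ∈ K₁ := by
    have h : zetaOf 12 L ^ 4 = (2 : L)⁻¹ * ((1 + 2 * zetaOf 12 L ^ 4) - 1) := by
      field_simp
      ring
    rw [h]
    exact mul_mem (inv_mem (by exact_mod_cast natCast_mem K₁ 2)) (sub_mem hmem (one_mem K₁))
  have h2 : ((unitResidues 12).filter fun t =>
      ∀ c ∈ unitResidues 12, (c * t ∈ residueSet 12 Φ ↔ c ∈ residueSet 12 Φ)).card = 2 := by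
    rw [hW]
    decide
  have hdeg := finrank_eq_two_of_primitive_of_card_eq_two hφ Φ Φ₁ h₁ hp₁ h2
  exact ⟨hmem, hω, eq_adjoin_of_mem_of_sq_eq_neg hmem (m := 3) (by norm_num) (by rw [sq_one_add_two_omega_twelve]; norm_num) hdeg,
    hdeg⟩

variable {Φ : CMType L} {A : AbelianVariety ℂ} {ι : 𝓞 L →+* End A} {θ : L →+* Module.End ℂ (complexBetti A.X 1)}

/-- **LEVEL `12`, «`L_{r,s,t} ∼ [ℤ(i)]²`» ON ABELIAN SURFACES**: `5 ∈ W` ⟹ `A ∼ E × E` (`𝓞_{K₁}`-equivariantly), `E` an ELLIPTIC CURVE with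
complex multiplication `𝓞_{K₁} → End E`, `K₁ = ℚ(ζ₁₂³)`, `(ζ₁₂³)² = −1`. [cite: BauerCosteItzyksonRuelle1997, §3.4]
[cite: KoblitzRohrlich1978, §1 p. 1184] [cite: Shimura1998, §8.2 Prop. 26, §6.2 Thm. 3] -/
theorem exists_isIsogeny_sq_elliptic_twelve_of_five_mem (hA : IsCMTypeRealisation Φ A ι θ)
    (h5 : (5 : ZMod 12) ∈ (unitResidues 12).filter fun t =>
        ∀ c ∈ unitResidues 12, (c * t ∈ residueSet 12 Φ ↔ c ∈ residueSet 12 Φ)) :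
    ∃ (K₁ : IntermediateField ℚ L) (Φ₁ : CMType K₁), IsCMField K₁ ∧
      zetaOf 12 L ^ 3 ∈ K₁ ∧ K₁ = IntermediateField.adjoin ℚ {zetaOf 12 L ^ 3} ∧
      (zetaOf 12 L ^ 3) ^ 2 = -1 ∧ Module.finrank ℚ K₁ = 2 ∧ A.dim = 2 ∧
      inducedCMType (algebraMap K₁ L) Φ₁ = Φ ∧
      ∃ (E : AbelianVariety ℂ) (ιE : 𝓞 K₁ →+* End E) (θE : K₁ →+* Module.End ℂ (complexBetti E.X 1)),
        IsCMTypeRealisation Φ₁ E ιE θE ∧ E.dim = 1 ∧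
        ∃ (P : AbelianVariety ℂ) (π : Fin 2 → (P ⟶ E)), Nonempty (IsLimit (Fan.mk P π)) ∧
          ∃ g : A ⟶ P, IsIsogeny g ∧
            ∀ j (b : 𝓞 K₁), ι (RingOfIntegers.mapRingHom (algebraMap K₁ L : K₁ →+* L) b) ≫ (g ≫ π j) =
              (g ≫ π j) ≫ ιE b := by
  haveI : IsCMField L := IsCyclotomicExtension.Rat.isCMField L (S := {12}) ⟨12, rfl, by norm_num⟩
  have hφ : Nat.totient 12 = 4 := by decide
  have hW := stabilizerResidues_eq_pair_of_mem (isCMResidueSet_residueSet 12 Φ) hφ h5 (by decide)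
  have h2 : ((unitResidues 12).filter fun t =>
      ∀ c ∈ unitResidues 12, (c * t ∈ residueSet 12 Φ ↔ c ∈ residueSet 12 Φ)).card = 2 := by
    rw [hW]
    decide
  obtain ⟨K₁, Φ₁, hCM, h₁, hp₁, hdeg, hdA, E, ιE, θE, hE, hdE, P, π, hP, g, hg, hequiv⟩ :=
    exists_isIsogeny_sq_elliptic_of_card_eq_two (N := 12) hφ hA h2
  obtain ⟨hmem, hK, -⟩ := eq_adjoin_sqrt_neg_one_of_five_mem_twelve Φ Φ₁ h₁ hp₁ h5
  exact ⟨K₁, Φ₁, hCM, hmem, hK, sq_zetaOf_pow_three_twelve, hdeg, hdA, h₁, E, ιE, θE, hE, hdE, P, π, hP, g, hg, hequiv⟩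

/-- **LEVEL `12`, «`L_{r,s,t} ∼ [ℤ(ω)]²`» ON ABELIAN SURFACES**: `7 ∈ W` ⟹ `A ∼ E × E`, `E` elliptic with CM by `𝓞_{K₁}`,
`K₁ = ℚ(1 + 2ζ₁₂⁴) ∋ ω = ζ₁₂⁴`, `(1 + 2ω)² = −3`. [cite: BauerCosteItzyksonRuelle1997, §3.4] [cite: KoblitzRohrlich1978, §1 p. 1184]
[cite: Shimura1998, §8.2 Prop. 26, §6.2 Thm. 3] -/
theorem exists_isIsogeny_sq_elliptic_twelve_of_seven_mem (hA : IsCMTypeRealisation Φ A ι θ)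
    (h7 : (7 : ZMod 12) ∈ (unitResidues 12).filter fun t =>
        ∀ c ∈ unitResidues 12, (c * t ∈ residueSet 12 Φ ↔ c ∈ residueSet 12 Φ)) :
    ∃ (K₁ : IntermediateField ℚ L) (Φ₁ : CMType K₁), IsCMField K₁ ∧
      1 + 2 * zetaOf 12 L ^ 4 ∈ K₁ ∧ zetaOf 12 L ^ 4 ∈ K₁ ∧ K₁ = IntermediateField.adjoin ℚ {1 + 2 * zetaOf 12 L ^ 4} ∧
      (1 + 2 * zetaOf 12 L ^ 4) ^ 2 = -3 ∧ Module.finrank ℚ K₁ = 2 ∧ A.dim = 2 ∧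
      inducedCMType (algebraMap K₁ L) Φ₁ = Φ ∧
      ∃ (E : AbelianVariety ℂ) (ιE : 𝓞 K₁ →+* End E) (θE : K₁ →+* Module.End ℂ (complexBetti E.X 1)),
        IsCMTypeRealisation Φ₁ E ιE θE ∧ E.dim = 1 ∧
        ∃ (P : AbelianVariety ℂ) (π : Fin 2 → (P ⟶ E)), Nonempty (IsLimit (Fan.mk P π)) ∧
          ∃ g : A ⟶ P, IsIsogeny g ∧
            ∀ j (b : 𝓞 K₁), ι (RingOfIntegers.mapRingHom (algebraMap K₁ L : K₁ →+* L) b) ≫ (g ≫ π j) =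
              (g ≫ π j) ≫ ιE b := by
  haveI : IsCMField L := IsCyclotomicExtension.Rat.isCMField L (S := {12}) ⟨12, rfl, by norm_num⟩
  have hφ : Nat.totient 12 = 4 := by decide
  have hW := stabilizerResidues_eq_pair_of_mem (isCMResidueSet_residueSet 12 Φ) hφ h7 (by decide)
  have h2 : ((unitResidues 12).filter fun t =>
      ∀ c ∈ unitResidues 12, (c * t ∈ residueSet 12 Φ ↔ c ∈ residueSet 12 Φ)).card = 2 := by
    rw [hW]
    decide
  obtain ⟨K₁, Φ₁, hCM, h₁, hp₁, hdeg, hdA, E, ιE, θE, hE, hdE, P, π, hP, g, hg, hequiv⟩ :=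
    exists_isIsogeny_sq_elliptic_of_card_eq_two (N := 12) hφ hA h2
  obtain ⟨hmem, hω, hK, -⟩ := eq_adjoin_sqrt_neg_three_of_seven_mem_twelve Φ Φ₁ h₁ hp₁ h7
  exact ⟨K₁, Φ₁, hCM, hmem, hω, hK, sq_one_add_two_omega_twelve, hdeg, hdA, h₁, E, ιE, θE, hE, hdE, P, π, hP, g, hg, hequiv⟩

/-- **Level `12`, every CM type**: every abelian variety with complex multiplication by `ℚ(ζ₁₂)` is a surface isogenous to `E × E` with
`E` an elliptic curve with complex multiplication by `ℚ(i) = ℚ(ζ₁₂³)` or by `ℚ(√−3) = ℚ(1 + 2ζ₁₂⁴)`. [cite: BauerCosteItzyksonRuelle1997, §3.4] -/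
theorem exists_isIsogeny_sq_elliptic_twelve (hA : IsCMTypeRealisation Φ A ι θ) :
    ∃ (K₁ : IntermediateField ℚ L) (Φ₁ : CMType K₁) (δ : L), IsCMField K₁ ∧ δ ∈ K₁ ∧
      K₁ = IntermediateField.adjoin ℚ {δ} ∧ (δ ^ 2 = -1 ∨ δ ^ 2 = -3) ∧ Module.finrank ℚ K₁ = 2 ∧ A.dim = 2 ∧
      inducedCMType (algebraMap K₁ L) Φ₁ = Φ ∧
      ∃ (E : AbelianVariety ℂ) (ιE : 𝓞 K₁ →+* End E) (θE : K₁ →+* Module.End ℂ (complexBetti E.X 1)),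
        IsCMTypeRealisation Φ₁ E ιE θE ∧ E.dim = 1 ∧
        ∃ (P : AbelianVariety ℂ) (π : Fin 2 → (P ⟶ E)), Nonempty (IsLimit (Fan.mk P π)) ∧ ∃ g : A ⟶ P, IsIsogeny g := by
  rcases stabilizerResidues_eq_or_twelve (isCMResidueSet_residueSet 12 Φ) with hW | hW
  · have h5 : (5 : ZMod 12) ∈ (unitResidues 12).filter fun t =>
        ∀ c ∈ unitResidues 12, (c * t ∈ residueSet 12 Φ ↔ c ∈ residueSet 12 Φ) := by
      rw [hW]; simp
    obtain ⟨K₁, Φ₁, hCM, hmem, hK, hsq, hdeg, hdA, h₁, E, ιE, θE, hE, hdE, P, π, hP, g, hg, -⟩ :=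
      exists_isIsogeny_sq_elliptic_twelve_of_five_mem hA h5
    exact ⟨K₁, Φ₁, _, hCM, hmem, hK, Or.inl hsq, hdeg, hdA, h₁, E, ιE, θE, hE, hdE, P, π, hP, g, hg⟩
  · have h7 : (7 : ZMod 12) ∈ (unitResidues 12).filter fun t =>
        ∀ c ∈ unitResidues 12, (c * t ∈ residueSet 12 Φ ↔ c ∈ residueSet 12 Φ) := by
      rw [hW]; simp
    obtain ⟨K₁, Φ₁, hCM, hmem, -, hK, hsq, hdeg, hdA, h₁, E, ιE, θE, hE, hdE, P, π, hP, g, hg, -⟩ :=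
      exists_isIsogeny_sq_elliptic_twelve_of_seven_mem hA h7
    exact ⟨K₁, Φ₁, _, hCM, hmem, hK, Or.inr hsq, hdeg, hdA, h₁, E, ιE, θE, hE, hdE, P, π, hP, g, hg⟩

end Twelve

/-! ## §3 The Koblitz–Rohrlich triples at levels `8` and `12`: examples and BCIR's counts `12 + 9 = 21`, `28 + 27 = 55` -/

namespace CyclotomicFermatCMType

section Counts

-- Examples at level `8` (`H_{1,1,6} = H_{1,3,4} = {1, 3}`, `H_{1,2,5} = H_{2,2,4} = {1, 5}`) are the sibling's
-- `fermatCMType_eight_values` (`CyclotomicFermatCMTypesTwoPowerLevelIsogenies`, K–R Theorem 4), reused in `exists_realisation_fermat_eight`.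

/-- **BCIR'S COUNT AT `n = 8`** («the complete decomposition of `F_8` follows by merely counting how many triplets have a `H_{r,s,t}` equal
to `{1,3}` or to `{1,5}`»; `F_8 ∼ [ℤ(√−2)]^{12} ⊕ [ℤ(i)]^9`): among the `21` admissible triples `(r, s, t)` with `0 < r, s, t < 8`,
`r + s + t = 8` (parametrised by `(r, s)`), exactly `12` have `H_{r,s,t} = {1, 3}` and exactly `9` have `H_{r,s,t} = {1, 5}` (among the
latter the three non-primitive `(2,2,4), (2,4,2), (4,2,2)`). [cite: BauerCosteItzyksonRuelle1997, §3.4] -/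
theorem card_triples_eight :
    ((Finset.univ : Finset (ZMod 8 × ZMod 8)).filter fun p =>
        p.1 ≠ 0 ∧ p.2 ≠ 0 ∧ p.1.val + p.2.val < 8).card = 21 ∧
    ((Finset.univ : Finset (ZMod 8 × ZMod 8)).filter fun p =>
        p.1 ≠ 0 ∧ p.2 ≠ 0 ∧ p.1.val + p.2.val < 8 ∧ fermatCMType 8 p.1 p.2 (-(p.1 + p.2)) = {1, 3}).card = 12 ∧
    ((Finset.univ : Finset (ZMod 8 × ZMod 8)).filter fun p =>
        p.1 ≠ 0 ∧ p.2 ≠ 0 ∧ p.1.val + p.2.val < 8 ∧ fermatCMType 8 p.1 p.2 (-(p.1 + p.2)) = {1, 5}).card = 9 ∧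
    ((Finset.univ : Finset (ZMod 8 × ZMod 8)).filter fun p =>
        p.1 ≠ 0 ∧ p.2 ≠ 0 ∧ p.1.val + p.2.val < 8 ∧ 1 < Nat.gcd (Nat.gcd p.1.val p.2.val) 8 ∧
          fermatCMType 8 p.1 p.2 (-(p.1 + p.2)) = {1, 5}).card = 3 := by
  refine ⟨?_, ?_, ?_, ?_⟩ <;> decide

/-- Examples at level `12`: `H_{1,1,10} = {1, 5}` (`ℚ(i)`), `H_{1,4,7} = {1, 7}` (`ℚ(ω)`), and the non-primitive `H_{3,3,6} = {1, 5}`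
(`n₀ = 4`: `ℤ(i)`), `H_{2,2,8} = H_{4,4,4} = {1, 7}` (`n₀ = 6, 3`: `ℤ(ω)`). [cite: BauerCosteItzyksonRuelle1997, §3.4] -/
theorem fermatCMType_twelve_examples :
    fermatCMType 12 1 1 10 = {1, 5} ∧ fermatCMType 12 1 4 7 = {1, 7} ∧ fermatCMType 12 3 3 6 = {1, 5} ∧
      fermatCMType 12 2 2 8 = {1, 7} ∧ fermatCMType 12 4 4 4 = {1, 7} := by
  refine ⟨?_, ?_, ?_, ?_, ?_⟩ <;> decide

/-- **BCIR'S COUNT AT `n = 12`** (`F_{12} ∼ [ℤ(ω)]^{28} ⊕ [ℤ(i)]^{27}`): among the `55` admissible triples mod `12` exactly `28` have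
`H_{r,s,t} = {1, 7}` (`ℚ(ω)`) and exactly `27` have `H_{r,s,t} = {1, 5}` (`ℚ(i)`); of these, `10` resp. `3` are non-primitive
(`n₀ ∈ {3, 6}` resp. `n₀ = 4`). [cite: BauerCosteItzyksonRuelle1997, §3.4] -/
theorem card_triples_twelve :
    ((Finset.univ : Finset (ZMod 12 × ZMod 12)).filter fun p =>
        p.1 ≠ 0 ∧ p.2 ≠ 0 ∧ p.1.val + p.2.val < 12).card = 55 ∧
    ((Finset.univ : Finset (ZMod 12 × ZMod 12)).filter fun p =>
        p.1 ≠ 0 ∧ p.2 ≠ 0 ∧ p.1.val + p.2.val < 12 ∧ fermatCMType 12 p.1 p.2 (-(p.1 + p.2)) = {1, 7}).card = 28 ∧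
    ((Finset.univ : Finset (ZMod 12 × ZMod 12)).filter fun p =>
        p.1 ≠ 0 ∧ p.2 ≠ 0 ∧ p.1.val + p.2.val < 12 ∧ fermatCMType 12 p.1 p.2 (-(p.1 + p.2)) = {1, 5}).card = 27 ∧
    ((Finset.univ : Finset (ZMod 12 × ZMod 12)).filter fun p =>
        p.1 ≠ 0 ∧ p.2 ≠ 0 ∧ p.1.val + p.2.val < 12 ∧ 1 < Nat.gcd (Nat.gcd p.1.val p.2.val) 12 ∧
          fermatCMType 12 p.1 p.2 (-(p.1 + p.2)) = {1, 7}).card = 10 ∧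
    ((Finset.univ : Finset (ZMod 12 × ZMod 12)).filter fun p =>
        p.1 ≠ 0 ∧ p.2 ≠ 0 ∧ p.1.val + p.2.val < 12 ∧ 1 < Nat.gcd (Nat.gcd p.1.val p.2.val) 12 ∧
          fermatCMType 12 p.1 p.2 (-(p.1 + p.2)) = {1, 5}).card = 3 := by
  refine ⟨?_, ?_, ?_, ?_, ?_⟩ <;> decide

set_option maxRecDepth 100000 in
/-- **BCIR'S COUNT AT `n = 24`** («for `n = 24`, there are 24 triplets `(r,s,t)` such that their `H_{r,s,t}` is not a group, for instance
`H_{1,3,20} = {1,5,11,17}`. The corresponding `L_{r,s,t}` are all equal and their product is `[L_{1,3,20}]^{24}`» and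
`F_{24} ∼ [ℂ⁴/L_{1,3,20}]^{24} ⊕ [product of 157 elliptic curves]`): among the `253` admissible triples mod `24` exactly `157` have `H_{r,s,t}`
closed under multiplication («`H` is a group»: the elliptic ones, sibling `exists_isIsogeny_pow_elliptic_fermat_iff_forall_mul_mem`) and
exactly `96 = 24 · 4` do not; the latter have `H` equal to one of the four unit multiples `{1,5,11,17}`, `{1,5,7,13}`, `{1,7,11,19}`,
`{1,13,17,19}` of `H_{1,3,20}`, `24` triples each (`24` copies of the simple fourfold of the sibling's
`isSimple_of_fermat_twentyFour_one_three_twenty`). [cite: BauerCosteItzyksonRuelle1997, §3.4] -/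
theorem card_triples_twentyFour :
    ((Finset.univ : Finset (ZMod 24 × ZMod 24)).filter fun p =>
        p.1 ≠ 0 ∧ p.2 ≠ 0 ∧ p.1.val + p.2.val < 24).card = 253 ∧
    ((Finset.univ : Finset (ZMod 24 × ZMod 24)).filter fun p =>
        p.1 ≠ 0 ∧ p.2 ≠ 0 ∧ p.1.val + p.2.val < 24 ∧
          ∀ a ∈ fermatCMType 24 p.1 p.2 (-(p.1 + p.2)), ∀ b ∈ fermatCMType 24 p.1 p.2 (-(p.1 + p.2)),
            a * b ∈ fermatCMType 24 p.1 p.2 (-(p.1 + p.2))).card = 157 ∧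
    ((Finset.univ : Finset (ZMod 24 × ZMod 24)).filter fun p =>
        p.1 ≠ 0 ∧ p.2 ≠ 0 ∧ p.1.val + p.2.val < 24 ∧ fermatCMType 24 p.1 p.2 (-(p.1 + p.2)) = {1, 5, 11, 17}).card = 24 ∧
    ((Finset.univ : Finset (ZMod 24 × ZMod 24)).filter fun p =>
        p.1 ≠ 0 ∧ p.2 ≠ 0 ∧ p.1.val + p.2.val < 24 ∧ fermatCMType 24 p.1 p.2 (-(p.1 + p.2)) = {1, 5, 7, 13}).card = 24 ∧
    ((Finset.univ : Finset (ZMod 24 × ZMod 24)).filter fun p =>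
        p.1 ≠ 0 ∧ p.2 ≠ 0 ∧ p.1.val + p.2.val < 24 ∧ fermatCMType 24 p.1 p.2 (-(p.1 + p.2)) = {1, 7, 11, 19}).card = 24 ∧
    ((Finset.univ : Finset (ZMod 24 × ZMod 24)).filter fun p =>
        p.1 ≠ 0 ∧ p.2 ≠ 0 ∧ p.1.val + p.2.val < 24 ∧ fermatCMType 24 p.1 p.2 (-(p.1 + p.2)) = {1, 13, 17, 19}).card = 24 := by
  refine ⟨?_, ?_, ?_, ?_, ?_, ?_⟩ <;> decide

end Counts

/-! ### On abelian varieties: the K–R types `Φ_{H_τ}` at levels `8` and `12` by their `H_τ` -/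

section Varieties

/-- `W(S) ∋ t` read off from `S = {1, t}` being its own stabiliser, level `8`. [cite: BauerCosteItzyksonRuelle1997, §3.4] -/
private theorem mem_stabilizerResidues_of_eq_pair_eight {S : Finset (ZMod 8)} (hS : IsCMResidueSet 8 S) {t : ZMod 8}
    (h : S = {1, t}) : t ∈ (unitResidues 8).filter fun u => ∀ c ∈ unitResidues 8, (c * u ∈ S ↔ c ∈ S) := by
  rw [← eq_stabilizerResidues_of_one_mem_eight hS (by rw [h]; simp), h]
  simp

/-- `W(S) ∋ t` read off from `S = {1, t}`, level `12`. [cite: BauerCosteItzyksonRuelle1997, §3.4] -/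
private theorem mem_stabilizerResidues_of_eq_pair_twelve {S : Finset (ZMod 12)} (hS : IsCMResidueSet 12 S) {t : ZMod 12}
    (h : S = {1, t}) : t ∈ (unitResidues 12).filter fun u => ∀ c ∈ unitResidues 12, (c * u ∈ S ↔ c ∈ S) := by
  rw [← eq_stabilizerResidues_of_one_mem_twelve hS (by rw [h]; simp), h]
  simp

variable {L : Type} [Field L] [NumberField L]

/-- **`n = 8`, «`L_{r,s,t} ∼ [ℤ(√−2)]²` when `H_{r,s,t} = {1,3}`», on abelian varieties**: for an admissible triple `τ` mod `8` with
`H_τ = {1, 3}` every abelian variety of type `Φ_{H_τ}` is a surface isogenous to `E × E`, `E` an elliptic curve with complex multiplication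
by `𝓞_{K₁}`, `K₁ = ℚ(ζ₈ + ζ₈³)`, `(ζ₈ + ζ₈³)² = −2`. [cite: BauerCosteItzyksonRuelle1997, §3.4] [cite: KoblitzRohrlich1978, §1 p. 1184] -/
theorem exists_isIsogeny_sq_elliptic_fermat_eight_of_eq_pair [IsCyclotomicExtension {8} ℚ L] {r s t : ZMod 8}
    {hS : ∀ c : ZMod 8, c.val.Coprime 8 → (c ∈ fermatCMType 8 r s t ↔ -c ∉ fermatCMType 8 r s t)}
    (hH : fermatCMType 8 r s t = {1, 3}) {A : AbelianVariety ℂ} {ι : 𝓞 L →+* End A}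
    {θ : L →+* Module.End ℂ (complexBetti A.X 1)} (hA : IsCMTypeRealisation (cmTypeOfResidues (L := L) (fermatCMType 8 r s t) hS) A ι θ) :
    ∃ (K₁ : IntermediateField ℚ L) (Φ₁ : CMType K₁), IsCMField K₁ ∧
      zetaOf 8 L + zetaOf 8 L ^ 3 ∈ K₁ ∧ K₁ = IntermediateField.adjoin ℚ {zetaOf 8 L + zetaOf 8 L ^ 3} ∧
      (zetaOf 8 L + zetaOf 8 L ^ 3) ^ 2 = -2 ∧ Module.finrank ℚ K₁ = 2 ∧ A.dim = 2 ∧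
      inducedCMType (algebraMap K₁ L) Φ₁ = cmTypeOfResidues (L := L) (fermatCMType 8 r s t) hS ∧
      ∃ (E : AbelianVariety ℂ) (ιE : 𝓞 K₁ →+* End E) (θE : K₁ →+* Module.End ℂ (complexBetti E.X 1)),
        IsCMTypeRealisation Φ₁ E ιE θE ∧ E.dim = 1 ∧
        ∃ (P : AbelianVariety ℂ) (π : Fin 2 → (P ⟶ E)), Nonempty (IsLimit (Fan.mk P π)) ∧
          ∃ g : A ⟶ P, IsIsogeny g ∧
            ∀ j (b : 𝓞 K₁), ι (RingOfIntegers.mapRingHom (algebraMap K₁ L : K₁ →+* L) b) ≫ (g ≫ π j) =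
              (g ≫ π j) ≫ ιE b := by
  have hcm : IsCMResidueSet 8 (fermatCMType 8 r s t) := isCMResidueSet_fermatCMType hS
  refine exists_isIsogeny_sq_elliptic_eight_of_three_mem hA ?_
  rw [residueSet_cmTypeOfResidues 8 hcm]
  exact mem_stabilizerResidues_of_eq_pair_eight hcm hH

/-- **`n = 8`, «`ℤ(i)` when `H_{r,s,t} = {1,5}`»**: `H_τ = {1, 5}` ⟹ every abelian variety of type `Φ_{H_τ}` is `∼ E × E`, `E` elliptic
with CM by `𝓞_{K₁}`, `K₁ = ℚ(ζ₈²)`, `(ζ₈²)² = −1`. [cite: BauerCosteItzyksonRuelle1997, §3.4] [cite: KoblitzRohrlich1978, §1 p. 1184] -/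
theorem exists_isIsogeny_sq_elliptic_fermat_eight_of_eq_pair' [IsCyclotomicExtension {8} ℚ L] {r s t : ZMod 8}
    {hS : ∀ c : ZMod 8, c.val.Coprime 8 → (c ∈ fermatCMType 8 r s t ↔ -c ∉ fermatCMType 8 r s t)}
    (hH : fermatCMType 8 r s t = {1, 5}) {A : AbelianVariety ℂ} {ι : 𝓞 L →+* End A}
    {θ : L →+* Module.End ℂ (complexBetti A.X 1)} (hA : IsCMTypeRealisation (cmTypeOfResidues (L := L) (fermatCMType 8 r s t) hS) A ι θ) :
    ∃ (K₁ : IntermediateField ℚ L) (Φ₁ : CMType K₁), IsCMField K₁ ∧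
      zetaOf 8 L ^ 2 ∈ K₁ ∧ K₁ = IntermediateField.adjoin ℚ {zetaOf 8 L ^ 2} ∧
      (zetaOf 8 L ^ 2) ^ 2 = -1 ∧ Module.finrank ℚ K₁ = 2 ∧ A.dim = 2 ∧
      inducedCMType (algebraMap K₁ L) Φ₁ = cmTypeOfResidues (L := L) (fermatCMType 8 r s t) hS ∧
      ∃ (E : AbelianVariety ℂ) (ιE : 𝓞 K₁ →+* End E) (θE : K₁ →+* Module.End ℂ (complexBetti E.X 1)),
        IsCMTypeRealisation Φ₁ E ιE θE ∧ E.dim = 1 ∧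
        ∃ (P : AbelianVariety ℂ) (π : Fin 2 → (P ⟶ E)), Nonempty (IsLimit (Fan.mk P π)) ∧
          ∃ g : A ⟶ P, IsIsogeny g ∧
            ∀ j (b : 𝓞 K₁), ι (RingOfIntegers.mapRingHom (algebraMap K₁ L : K₁ →+* L) b) ≫ (g ≫ π j) =
              (g ≫ π j) ≫ ιE b := by
  have hcm : IsCMResidueSet 8 (fermatCMType 8 r s t) := isCMResidueSet_fermatCMType hS
  refine exists_isIsogeny_sq_elliptic_eight_of_five_mem hA ?_
  rw [residueSet_cmTypeOfResidues 8 hcm]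
  exact mem_stabilizerResidues_of_eq_pair_eight hcm hH

/-- **`n = 12`, «`{1,5}` yielding `L_{r,s,t} ∼ [ℤ(i)]²`»**: `H_τ = {1, 5}` ⟹ every abelian variety of type `Φ_{H_τ}` is `∼ E × E`, `E`
elliptic with CM by `𝓞_{K₁}`, `K₁ = ℚ(ζ₁₂³)`, `(ζ₁₂³)² = −1`. [cite: BauerCosteItzyksonRuelle1997, §3.4] [cite: KoblitzRohrlich1978, §1 p. 1184] -/
theorem exists_isIsogeny_sq_elliptic_fermat_twelve_of_eq_pair [IsCyclotomicExtension {12} ℚ L] {r s t : ZMod 12}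
    {hS : ∀ c : ZMod 12, c.val.Coprime 12 → (c ∈ fermatCMType 12 r s t ↔ -c ∉ fermatCMType 12 r s t)}
    (hH : fermatCMType 12 r s t = {1, 5}) {A : AbelianVariety ℂ} {ι : 𝓞 L →+* End A}
    {θ : L →+* Module.End ℂ (complexBetti A.X 1)}
    (hA : IsCMTypeRealisation (cmTypeOfResidues (L := L) (fermatCMType 12 r s t) hS) A ι θ) :
    ∃ (K₁ : IntermediateField ℚ L) (Φ₁ : CMType K₁), IsCMField K₁ ∧
      zetaOf 12 L ^ 3 ∈ K₁ ∧ K₁ = IntermediateField.adjoin ℚ {zetaOf 12 L ^ 3} ∧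
      (zetaOf 12 L ^ 3) ^ 2 = -1 ∧ Module.finrank ℚ K₁ = 2 ∧ A.dim = 2 ∧
      inducedCMType (algebraMap K₁ L) Φ₁ = cmTypeOfResidues (L := L) (fermatCMType 12 r s t) hS ∧
      ∃ (E : AbelianVariety ℂ) (ιE : 𝓞 K₁ →+* End E) (θE : K₁ →+* Module.End ℂ (complexBetti E.X 1)),
        IsCMTypeRealisation Φ₁ E ιE θE ∧ E.dim = 1 ∧
        ∃ (P : AbelianVariety ℂ) (π : Fin 2 → (P ⟶ E)), Nonempty (IsLimit (Fan.mk P π)) ∧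
          ∃ g : A ⟶ P, IsIsogeny g ∧
            ∀ j (b : 𝓞 K₁), ι (RingOfIntegers.mapRingHom (algebraMap K₁ L : K₁ →+* L) b) ≫ (g ≫ π j) =
              (g ≫ π j) ≫ ιE b := by
  have hcm : IsCMResidueSet 12 (fermatCMType 12 r s t) := isCMResidueSet_fermatCMType hS
  refine exists_isIsogeny_sq_elliptic_twelve_of_five_mem hA ?_
  rw [residueSet_cmTypeOfResidues 12 hcm]
  exact mem_stabilizerResidues_of_eq_pair_twelve hcm hH

/-- **`n = 12`, «`{1,7}` yielding `L_{r,s,t} ∼ [ℤ(ω)]²`»**: `H_τ = {1, 7}` ⟹ `A ∼ E × E`, `E` elliptic with CM by `𝓞_{K₁}`,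
`K₁ = ℚ(1 + 2ζ₁₂⁴) ∋ ω`, `(1 + 2ω)² = −3`. [cite: BauerCosteItzyksonRuelle1997, §3.4] [cite: KoblitzRohrlich1978, §1 p. 1184] -/
theorem exists_isIsogeny_sq_elliptic_fermat_twelve_of_eq_pair' [IsCyclotomicExtension {12} ℚ L] {r s t : ZMod 12}
    {hS : ∀ c : ZMod 12, c.val.Coprime 12 → (c ∈ fermatCMType 12 r s t ↔ -c ∉ fermatCMType 12 r s t)}
    (hH : fermatCMType 12 r s t = {1, 7}) {A : AbelianVariety ℂ} {ι : 𝓞 L →+* End A}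
    {θ : L →+* Module.End ℂ (complexBetti A.X 1)}
    (hA : IsCMTypeRealisation (cmTypeOfResidues (L := L) (fermatCMType 12 r s t) hS) A ι θ) :
    ∃ (K₁ : IntermediateField ℚ L) (Φ₁ : CMType K₁), IsCMField K₁ ∧
      1 + 2 * zetaOf 12 L ^ 4 ∈ K₁ ∧ zetaOf 12 L ^ 4 ∈ K₁ ∧ K₁ = IntermediateField.adjoin ℚ {1 + 2 * zetaOf 12 L ^ 4} ∧
      (1 + 2 * zetaOf 12 L ^ 4) ^ 2 = -3 ∧ Module.finrank ℚ K₁ = 2 ∧ A.dim = 2 ∧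
      inducedCMType (algebraMap K₁ L) Φ₁ = cmTypeOfResidues (L := L) (fermatCMType 12 r s t) hS ∧
      ∃ (E : AbelianVariety ℂ) (ιE : 𝓞 K₁ →+* End E) (θE : K₁ →+* Module.End ℂ (complexBetti E.X 1)),
        IsCMTypeRealisation Φ₁ E ιE θE ∧ E.dim = 1 ∧
        ∃ (P : AbelianVariety ℂ) (π : Fin 2 → (P ⟶ E)), Nonempty (IsLimit (Fan.mk P π)) ∧
          ∃ g : A ⟶ P, IsIsogeny g ∧
            ∀ j (b : 𝓞 K₁), ι (RingOfIntegers.mapRingHom (algebraMap K₁ L : K₁ →+* L) b) ≫ (g ≫ π j) =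
              (g ≫ π j) ≫ ιE b := by
  have hcm : IsCMResidueSet 12 (fermatCMType 12 r s t) := isCMResidueSet_fermatCMType hS
  refine exists_isIsogeny_sq_elliptic_twelve_of_seven_mem hA ?_
  rw [residueSet_cmTypeOfResidues 12 hcm]
  exact mem_stabilizerResidues_of_eq_pair_twelve hcm hH

/-- Non-vacuity at level `8`: the types `Φ_{H_{1,1,6}}` (`ℚ(√−2)`) and `Φ_{H_{1,2,5}}` (`ℚ(i)`) are realised by abelian surfaces.
[cite: Shimura1998, §6.2 Thm. 3] [cite: BauerCosteItzyksonRuelle1997, §3.4] -/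
theorem exists_realisation_fermat_eight [IsCyclotomicExtension {8} ℚ L] :
    (fermatCMType 8 1 1 6 = {1, 3} ∧
      ∃ (hS : ∀ c : ZMod 8, c.val.Coprime 8 → (c ∈ fermatCMType 8 1 1 6 ↔ -c ∉ fermatCMType 8 1 1 6))
        (A : AbelianVariety ℂ) (ι : 𝓞 L →+* End A) (θ : L →+* Module.End ℂ (complexBetti A.X 1)),
        IsCMTypeRealisation (cmTypeOfResidues (L := L) (fermatCMType 8 1 1 6) hS) A ι θ ∧ A.dim = 2) ∧
    (fermatCMType 8 1 2 5 = {1, 5} ∧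
      ∃ (hS : ∀ c : ZMod 8, c.val.Coprime 8 → (c ∈ fermatCMType 8 1 2 5 ↔ -c ∉ fermatCMType 8 1 2 5))
        (A : AbelianVariety ℂ) (ι : 𝓞 L →+* End A) (θ : L →+* Module.End ℂ (complexBetti A.X 1)),
        IsCMTypeRealisation (cmTypeOfResidues (L := L) (fermatCMType 8 1 2 5) hS) A ι θ ∧ A.dim = 2) := by
  refine ⟨⟨fermatCMType_eight_values.1, ?_⟩, ⟨fermatCMType_eight_values.2.2.1, ?_⟩⟩
  · obtain ⟨hS, A, ι, θ, hA, hd⟩ := exists_isCMTypeRealisation_fermat (L := L) (M := 8) (by norm_num)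
      (r := 1) (s := 1) (t := 6) (by decide) (by decide) (by decide) (by decide)
    exact ⟨hS, A, ι, θ, hA, by rw [hd]; decide⟩
  · obtain ⟨hS, A, ι, θ, hA, hd⟩ := exists_isCMTypeRealisation_fermat (L := L) (M := 8) (by norm_num)
      (r := 1) (s := 2) (t := 5) (by decide) (by decide) (by decide) (by decide)
    exact ⟨hS, A, ι, θ, hA, by rw [hd]; decide⟩

/-- Non-vacuity at level `12`: `Φ_{H_{1,1,10}}` (`ℚ(i)`) and `Φ_{H_{1,4,7}}` (`ℚ(ω)`) are realised by abelian surfaces.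
[cite: Shimura1998, §6.2 Thm. 3] [cite: BauerCosteItzyksonRuelle1997, §3.4] -/
theorem exists_realisation_fermat_twelve [IsCyclotomicExtension {12} ℚ L] :
    (∃ (hS : ∀ c : ZMod 12, c.val.Coprime 12 → (c ∈ fermatCMType 12 1 1 10 ↔ -c ∉ fermatCMType 12 1 1 10))
      (A : AbelianVariety ℂ) (ι : 𝓞 L →+* End A) (θ : L →+* Module.End ℂ (complexBetti A.X 1)),
      IsCMTypeRealisation (cmTypeOfResidues (L := L) (fermatCMType 12 1 1 10) hS) A ι θ ∧ A.dim = 2) ∧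
    (∃ (hS : ∀ c : ZMod 12, c.val.Coprime 12 → (c ∈ fermatCMType 12 1 4 7 ↔ -c ∉ fermatCMType 12 1 4 7))
      (A : AbelianVariety ℂ) (ι : 𝓞 L →+* End A) (θ : L →+* Module.End ℂ (complexBetti A.X 1)),
      IsCMTypeRealisation (cmTypeOfResidues (L := L) (fermatCMType 12 1 4 7) hS) A ι θ ∧ A.dim = 2) := by
  constructor
  · obtain ⟨hS, A, ι, θ, hA, hd⟩ := exists_isCMTypeRealisation_fermat (L := L) (M := 12) (by norm_num)
      (r := 1) (s := 1) (t := 10) (by decide) (by decide) (by decide) (by decide)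
    exact ⟨hS, A, ι, θ, hA, by rw [hd]; decide⟩
  · obtain ⟨hS, A, ι, θ, hA, hd⟩ := exists_isCMTypeRealisation_fermat (L := L) (M := 12) (by norm_num)
      (r := 1) (s := 4) (t := 7) (by decide) (by decide) (by decide) (by decide)
    exact ⟨hS, A, ι, θ, hA, by rw [hd]; decide⟩

end Varieties

end CyclotomicFermatCMType

end Literature.AlgebraicGeometry.ComplexMultiplication
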